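import Summits.Ventures.PercRepro.CoreCountWrapper

/-!
# PercRepro — a `5`-set of rank `≤ 3` contains a `4`-circuit (p2, gen 12)

Under (C1) (lines have `≤ 3` points) in a simple matroid, two distinct triangles share at most one point
(`ncard_inter_le_one_of_triangles`: otherwise their union is a `4`-point line). Hence a `5`-set `X` of rank `≤ 3`
contains a `4`-element circuit (**`exists_isCircuit_four_of_five`**): if it did not, every dependent subset of `X`
would carry a triangle; take a triangle `T₁ ⊆ X` and the two points `W = X ∖ T₁`; for each `t ∈ T₁` the `4`-set
`X ∖ {t}` is dependent and carries a triangle `T_t ≠ T₁`, which meets `T₁` in `≤ 1` point and therefore contains `W`;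
all the `T_t` contain the two points of `W`, so they coincide; the common triangle then avoids every `t ∈ T₁`, i.e.
lies in the `2`-set `W` — impossible. (Exhaustively confirmed over the `5`-point triangle systems,
mining/p2/g12/check5.py.)

* `eRk_eq_two_of_isCircuit_three`, `three_le_ncard_of_isCircuit`, `dep_of_eRk_lt_ncard` — small helpers;
* `ncard_inter_le_one_of_triangles`, **`exists_isCircuit_four_of_five`**.
Imports `CoreCountWrapper` only (the three rank helpers of `CoreFourNullity` are repeated here, primed, so that the two
files can land side by side). Axioms: standard.
-/

namespace PercRepro
namespace CoreFour

open Set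

variable {α : Type} {M : Matroid α}

/-! ### Rank helpers (the primed twins of `CoreFourNullity`'s, so that this file imports the tree only) -/

/-- In a finite matroid every set has a natural-number rank. -/
theorem exists_eRk_eq_nat' [M.Finite] (X : Set α) : ∃ r : ℕ, M.eRk X = (r : ℕ∞) := by
  have hR : M.eRank ≠ ⊤ := (Matroid.eRank_ne_top_iff M).2 inferInstance
  have h : M.eRk X ≠ ⊤ := ne_top_of_le_ne_top hR (M.eRk_le_eRank X)
  obtain ⟨r, hr⟩ := ENat.ne_top_iff_exists.1 h
  exact ⟨r, hr.symm⟩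

/-- A set with `≥ 2` points of a simple matroid has rank `≥ 2`. -/
theorem two_le_eRk_of_two_le_ncard' [M.Finite] (hs : ∀ e ∈ M.E, ∀ f ∈ M.E, e ≠ f → M.eRk {e, f} = 2)
    {Y : Set α} (hY : Y ⊆ M.E) (h2 : 2 ≤ Y.ncard) : 2 ≤ M.eRk Y := by
  have hYfin : Y.Finite := M.ground_finite.subset hY
  obtain ⟨e, f, he, hf, hef⟩ := (Set.one_lt_ncard_iff hYfin).1 (by omega)
  have h := hs e (hY he) f (hY hf) hef
  rw [← h]
  exact M.eRk_mono (Set.pair_subset he hf)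

/-- Under (C1) a set with `≥ 4` points has rank `≥ 3`. -/
theorem three_le_eRk_of_four_le_ncard' [M.Finite] (hs : ∀ e ∈ M.E, ∀ f ∈ M.E, e ≠ f → M.eRk {e, f} = 2)
    (hC1 : ∀ L ⊆ M.E, M.eRk L = 2 → L.ncard ≤ 3)
    {Y : Set α} (hY : Y ⊆ M.E) (h4 : 4 ≤ Y.ncard) : 3 ≤ M.eRk Y := by
  obtain ⟨r, hr⟩ := exists_eRk_eq_nat' (M := M) Y
  have h2 := two_le_eRk_of_two_le_ncard' hs hY (by omega)
  rw [hr] at h2 ⊢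
  have h2' : 2 ≤ r := by exact_mod_cast h2
  by_contra hlt
  have hlt' : r < 3 := by exact_mod_cast (not_le.1 hlt)
  have hr2 : r = 2 := by omega
  rw [hr2] at hr
  have := hC1 Y hY (by rw [hr]; rfl)
  omega

/-! ### A `5`-set of rank `≤ 3` contains a `4`-circuit -/

/-- A circuit with `3` elements has rank `2`. -/
theorem eRk_eq_two_of_isCircuit_three [M.Finite] {T : Set α} (hT : M.IsCircuit T) (hT3 : T.ncard = 3) :
    M.eRk T = 2 := by
  have hfin : T.Finite := M.ground_finite.subset hT.subset_ground
  have h := hT.eRk_add_one_eq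
  rw [← hfin.cast_ncard_eq, hT3] at h
  obtain ⟨r, hr⟩ := exists_eRk_eq_nat' (M := M) T
  rw [hr] at h ⊢
  have : r + 1 = 3 := by exact_mod_cast h
  have : r = 2 := by omega
  rw [this]; rfl

/-- **Two distinct triangles share at most one point** under (C1): otherwise their union has `4` points and rank `≤ 2`. -/
theorem ncard_inter_le_one_of_triangles [M.Finite] (hs : ∀ e ∈ M.E, ∀ f ∈ M.E, e ≠ f → M.eRk {e, f} = 2)
    (hC1 : ∀ L ⊆ M.E, M.eRk L = 2 → L.ncard ≤ 3)
    {T T' : Set α} (hT : M.IsCircuit T) (hT3 : T.ncard = 3) (hT' : M.IsCircuit T') (hT'3 : T'.ncard = 3)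
    (hne : T ≠ T') : (T ∩ T').ncard ≤ 1 := by
  by_contra hlt
  push Not at hlt
  have hTE : T ⊆ M.E := hT.subset_ground
  have hT'E : T' ⊆ M.E := hT'.subset_ground
  have hTfin : T.Finite := M.ground_finite.subset hTE
  have hT'fin : T'.Finite := M.ground_finite.subset hT'E
  -- `|T ∩ T'| = 2`
  have hI3 : (T ∩ T').ncard ≤ 2 := by
    by_contra h
    push Not at h
    have heq : T ∩ T' = T := Set.eq_of_subset_of_ncard_le Set.inter_subset_left (by omega) hTfin
    have hsub : T ⊆ T' := by rw [← heq]; exact Set.inter_subset_right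
    exact hne (Set.eq_of_subset_of_ncard_le hsub (by omega) hT'fin)
  have hIE := Set.ncard_inter_add_ncard_union T T' hTfin hT'fin
  have hU4 : 4 ≤ (T ∪ T').ncard := by omega
  -- ranks
  have hrT := eRk_eq_two_of_isCircuit_three hT hT3
  have hrT' := eRk_eq_two_of_isCircuit_three hT' hT'3
  have hrI := two_le_eRk_of_two_le_ncard' hs (Set.inter_subset_left.trans hTE)
    (by omega : 2 ≤ (T ∩ T').ncard)
  have hrU := three_le_eRk_of_four_le_ncard' hs hC1 (Set.union_subset hTE hT'E) hU4
  have hsub := M.eRk_inter_add_eRk_union_le T T'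
  rw [hrT, hrT'] at hsub
  obtain ⟨rI, hrI'⟩ := exists_eRk_eq_nat' (M := M) (T ∩ T')
  obtain ⟨rU, hrU'⟩ := exists_eRk_eq_nat' (M := M) (T ∪ T')
  rw [hrI'] at hrI hsub
  rw [hrU'] at hrU hsub
  have e1 : 2 ≤ rI := by exact_mod_cast hrI
  have e2 : 3 ≤ rU := by exact_mod_cast hrU
  have e3 : rI + rU ≤ 2 + 2 := by exact_mod_cast hsub
  omega

/-- In a simple matroid of rank `≥ 2` every circuit has `≥ 3` elements (as `ncard`). -/
theorem three_le_ncard_of_isCircuit [M.Finite] (hs : ∀ e ∈ M.E, ∀ f ∈ M.E, e ≠ f → M.eRk {e, f} = 2)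
    (hrank : 2 ≤ M.eRank) {C : Set α} (hC : M.IsCircuit C) : 3 ≤ C.ncard := by
  have hCE : C ⊆ M.E := hC.subset_ground
  have hCfin : C.Finite := M.ground_finite.subset hCE
  have hr := hC.eRk_add_one_eq
  rw [← hCfin.cast_ncard_eq] at hr
  obtain ⟨r, hr'⟩ := exists_eRk_eq_nat' (M := M) C
  rw [hr'] at hr
  have e1 : r + 1 = C.ncard := by exact_mod_cast hr
  by_contra hlt
  push Not at hlt
  -- `r ≤ 1`: `C` has `1` or `2` points
  have hpos : 0 < C.ncard := (Set.ncard_pos hCfin).2 hC.nonempty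
  rcases (show C.ncard = 1 ∨ C.ncard = 2 by omega) with h1 | h2
  · -- a loop `x`, yet `r{x, f} = 2` for some `f ≠ x`
    obtain ⟨x, rfl⟩ := Set.ncard_eq_one.1 h1
    have hx0 : M.eRk {x} = 0 := by rw [hr']; exact_mod_cast (show r = 0 by omega)
    have hxE : x ∈ M.E := hCE (Set.mem_singleton x)
    obtain ⟨f, hf, hfx⟩ : ∃ f ∈ M.E, f ≠ x := by
      by_contra hall
      push Not at hall
      have hsub : M.E ⊆ {x} := fun f hf => by rw [Set.mem_singleton_iff]; exact hall f hf
      have : M.eRank ≤ M.eRk {x} := by rw [← M.eRk_ground]; exact M.eRk_mono hsub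
      rw [hx0] at this
      have : (2 : ℕ∞) ≤ 0 := hrank.trans this
      norm_num at this
    have h2 := hs x hxE f hf (Ne.symm hfx)
    have hle : M.eRk {x, f} ≤ M.eRk {x} + M.eRk {f} := by
      rw [Set.insert_eq]; exact M.eRk_union_le_eRk_add_eRk _ _
    have hf1 : M.eRk {f} ≤ 1 := by
      have := M.eRk_le_encard {f}
      rwa [Set.encard_singleton] at this
    rw [h2, hx0, zero_add] at hle
    have : (2 : ℕ∞) ≤ 1 := hle.trans hf1
    norm_num at this
  · -- a two-element circuit has rank `1`, against `r{x, y} = 2`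
    obtain ⟨x, y, hxy, rfl⟩ := Set.ncard_eq_two.1 h2
    have hxE : x ∈ M.E := hCE (by simp)
    have hyE : y ∈ M.E := hCE (by simp)
    have h2' := hs x hxE y hyE hxy
    rw [h2', ] at hr'
    have : (2 : ℕ) = r := by exact_mod_cast hr'
    omega

/-- A subset of rank `< |Y|` is dependent. -/
theorem dep_of_eRk_lt_ncard [M.Finite] {Y : Set α} (hY : Y ⊆ M.E) (h : M.eRk Y < Y.ncard) : M.Dep Y := by
  rw [Matroid.dep_iff]
  refine ⟨fun hind => ?_, hY⟩
  have hfin : Y.Finite := M.ground_finite.subset hY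
  have h' := hind.eRk_eq_encard
  rw [← hfin.cast_ncard_eq] at h'
  rw [h'] at h
  exact lt_irrefl _ h

/-- **A `5`-set of rank `≤ 3` contains a `4`-circuit** (simple, (C1)). If it did not, every `4`-subset would carry a
triangle; take a triangle `T₁ ⊆ X` and the two points `W = X ∖ T₁`; for `t ∈ T₁` the triangle in `X ∖ {t}` differs from
`T₁`, so meets it in `≤ 1` point, so contains `W`; all these triangles contain `W`, hence coincide, hence avoid every
`t ∈ T₁` — a triangle inside the `2`-set `W`. -/
theorem exists_isCircuit_four_of_five [M.Finite] (hs : ∀ e ∈ M.E, ∀ f ∈ M.E, e ≠ f → M.eRk {e, f} = 2)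
    (hC1 : ∀ L ⊆ M.E, M.eRk L = 2 → L.ncard ≤ 3)
    {X : Set α} (hX : X ⊆ M.E) (hX5 : X.ncard = 5) (hr : M.eRk X ≤ 3) :
    ∃ C ⊆ X, M.IsCircuit C ∧ C.ncard = 4 := by
  classical
  have hXfin : X.Finite := M.ground_finite.subset hX
  have hrank : 2 ≤ M.eRank :=
    (two_le_eRk_of_two_le_ncard' hs hX (by omega)).trans (M.eRk_le_eRank X)
  by_contra hno
  push Not at hno
  -- every dependent subset `Y ⊆ X` carries a triangle
  have htri : ∀ Y ⊆ X, M.Dep Y → ∃ T ⊆ Y, M.IsCircuit T ∧ T.ncard = 3 := by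
    intro Y hYX hdep
    obtain ⟨C, hCY, hC⟩ := hdep.exists_isCircuit_subset
    have hCfin : C.Finite := hXfin.subset (hCY.trans hYX)
    have h3 := three_le_ncard_of_isCircuit hs hrank hC
    have h4 : C.ncard ≤ 4 := by
      have h := hC.eRk_add_one_eq
      have hle : M.eRk C ≤ 3 := (M.eRk_mono (hCY.trans hYX)).trans hr
      obtain ⟨r, hr'⟩ := exists_eRk_eq_nat' (M := M) C
      rw [hr', ← hCfin.cast_ncard_eq] at h
      rw [hr'] at hle
      have e1 : r + 1 = C.ncard := by exact_mod_cast h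
      have e2 : r ≤ 3 := by exact_mod_cast hle
      omega
    rcases Nat.lt_or_ge C.ncard 4 with hlt | hge
    · exact ⟨C, hCY, hC, by omega⟩
    · exact (hno C (hCY.trans hYX) hC (by omega)).elim
  -- a first triangle `T₁ ⊆ X`
  obtain ⟨T₁, hT₁X, hT₁, hT₁3⟩ := htri X le_rfl
    (dep_of_eRk_lt_ncard hX (by rw [hX5]; exact lt_of_le_of_lt hr (by norm_num)))
  have hT₁fin : T₁.Finite := hXfin.subset hT₁X
  set W := X \ T₁ with hW
  have hW2 : W.ncard = 2 := by
    rw [hW, Set.ncard_sdiff hT₁X hT₁fin, hX5, hT₁3]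
  have hWfin : W.Finite := hXfin.subset sdiff_subset
  -- for each `t ∈ T₁`, a triangle in `X ∖ {t}`, which then contains `W`
  have hT : ∀ t ∈ T₁, ∃ T ⊆ X \ {t}, M.IsCircuit T ∧ T.ncard = 3 := by
    intro t ht
    have hYX : X \ {t} ⊆ X := sdiff_subset
    have hY4 : (X \ {t}).ncard = 4 := by
      rw [Set.ncard_sdiff (Set.singleton_subset_iff.2 (hT₁X ht)) (Set.finite_singleton t), hX5,
        Set.ncard_singleton]
    exact htri (X \ {t}) hYX (dep_of_eRk_lt_ncard (hYX.trans hX)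
      (by rw [hY4]; exact lt_of_le_of_lt ((M.eRk_mono hYX).trans hr) (by norm_num)))
  choose! f hf using hT
  have hWf : ∀ t ∈ T₁, W ⊆ f t := by
    intro t ht
    obtain ⟨hfX, hfc, hf3⟩ := hf t ht
    have hne : f t ≠ T₁ := by
      intro h
      have : t ∈ f t := by rw [h]; exact ht
      exact (hfX this).2 rfl
    have hI := ncard_inter_le_one_of_triangles hs hC1 hfc hf3 hT₁ hT₁3 hne
    have hffin : (f t).Finite := hXfin.subset (hfX.trans sdiff_subset)
    -- `f t ∖ T₁ ⊆ W` has `≥ 2` points, so equals `W`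
    have hsub : f t \ T₁ ⊆ W := Set.sdiff_subset_sdiff_left (hfX.trans sdiff_subset)
    have hcard : (f t ∩ T₁).ncard + (f t \ T₁).ncard = (f t).ncard :=
      Set.ncard_inter_add_ncard_sdiff_eq_ncard (f t) T₁ hffin
    have heq : f t \ T₁ = W := Set.eq_of_subset_of_ncard_le hsub (by omega) hWfin
    rw [← heq]; exact sdiff_subset
  -- all these triangles coincide
  obtain ⟨t₀, ht₀⟩ : T₁.Nonempty := by
    rw [Set.nonempty_iff_ne_empty]; rintro rfl; simp at hT₁3
  have hsame : ∀ t ∈ T₁, f t = f t₀ := by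
    intro t ht
    by_contra hne
    obtain ⟨hfX, hfc, hf3⟩ := hf t ht
    obtain ⟨hfX₀, hfc₀, hf₀3⟩ := hf t₀ ht₀
    have hI := ncard_inter_le_one_of_triangles hs hC1 hfc hf3 hfc₀ hf₀3 hne
    have hWsub : W ⊆ f t ∩ f t₀ := Set.subset_inter (hWf t ht) (hWf t₀ ht₀)
    have hffin : (f t ∩ f t₀).Finite := hXfin.subset (Set.inter_subset_left.trans (hfX.trans sdiff_subset))
    have := Set.ncard_le_ncard hWsub hffin
    omega
  -- so `f t₀` avoids every point of `T₁`: it lies in `W`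
  have hdisj : f t₀ ⊆ W := by
    intro x hx
    obtain ⟨hfX₀, _, _⟩ := hf t₀ ht₀
    refine ⟨(hfX₀ hx).1, fun hxT => ?_⟩
    have := (hf x hxT).1
    rw [hsame x hxT] at this
    exact (this hx).2 rfl
  obtain ⟨_, _, hf₀3⟩ := hf t₀ ht₀
  have := Set.ncard_le_ncard hdisj hWfin
  omega

end CoreFour
end PercRepro
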